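import Mathlib.NumberTheory.NumberField.Units.Basic
import Mathlib.Topology.Algebra.Group.Basic
import Literature.AlgebraicGeometry.Frobenioids.ArithmeticFrobenioidHypotheses
import Literature.AlgebraicGeometry.Frobenioids.ArithmeticDivisorsUnits
import Literature.AlgebraicGeometry.Frobenioids.ModelFrobenioidUnits
import Literature.AlgebraicGeometry.Frobenioids.BaseFrobeniusSections
import HarnessLib

/-!
# Frobenioids I, Example 6.3 / Def. 2.8 (i): the arithmetic Frobenioid `C_{K/F}` is of unit-profinite type

Mochizuki, *The geometry of Frobenioids I: the general theory*, Kyushu J. Math. **62** (2008),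
Example 6.3, kurims p. 113: for an object `A` of the arithmetic Frobenioid over `Spec(L)`,
"`O^×(A) = O^▷(A) = μ(L)`" [cite: MochizukiFrdI2008, Ex. 6.3 p.113]; Definition 2.8 (i), p. 52: `C` is
*of unit-profinite type* if every `O^×(A)` "admits a [uniquely determined] profinite topology" making it
"a topologically finitely generated profinite [abelian] group" [cite: MochizukiFrdI2008, Def. 2.8(i) p.52]
(v2, docstring-only: the author's bracket «[uniquely determined]», p. 52 ll. 27–28, restored inside the quote —
referee finding J16-F2; no declaration changed).

PROOF-ONLY file (abc-iut-L1-t5 gen 3). For THE constructed arithmetic model Frobenioid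
`C_{K/F} = arithFrobenioid F K` (abc-iut-L6-t10, `ArithmeticFrobenioidModel.lean`) the unit group
`O^×(A)` of [FrdI] Def. 1.2 (ii) (found's `PreFrobenioid.unitsSubgroup` for the functor `C → F_Φ` of
Thm. 5.2 (i)) is FINITE — it embeds (abc-iut-L2-t9's `ModelFrobenioid.unitsToRatFn`, injective since
`Φ(L)` is integral) into the elements of `L^×` of vanishing arithmetic divisor, which come from the
(finite) torsion of `(𝓞 L)^×` (Kronecker; the div-level statement is abc-iut-L1-t3's
`principalArithDivisor_eq_zero_iff`) — hence, with the discrete topology, a topologically finitely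
generated profinite group: **`C_{K/F}` is of unit-profinite type** (`isOfUnitProfiniteType_arith`).

This is the Def. 2.8 (i) antecedent of [FrdI] Cor. 5.7 (iii)/(iv) at `C_{K/F}` (typed
`PreFrobenioid.Cor57iii` / `Cor57iv`, closed at the arithmetic Frobenioids in
`BaseSectionsOfObjectsCor57Arith.lean`), which therefore is not idle there. Not a numbered assertion of
Thm. 6.4; no definitions, no named facts; nothing here bears on, or takes a side on, [IUTchIII] Cor. 3.12.
-/

noncomputable section

namespace Literature.AlgebraicGeometry.Frobenioids

open CategoryTheory Opposite NumberField

/-! ### A finite group admits a topologically finitely generated profinite topology -/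

section FiniteGroup

variable (M : Type*) [Group M] [Finite M]

/-- A finite group, with the discrete topology, is a topologically finitely generated profinite group;
in particular it "admits" such a topology (Def. 2.8 (i)). [cite: MochizukiFrdI2008, Def. 2.8(i) p.52] -/
theorem AdmitsTfgProfiniteTopology.of_finite : AdmitsTfgProfiniteTopology M := by
  classical
  letI : TopologicalSpace M := ⊥
  haveI : DiscreteTopology M := ⟨rfl⟩
  haveI : Fintype M := Fintype.ofFinite M
  refine ⟨⊥, ⟨?_, inferInstance, inferInstance, inferInstance, ?_⟩⟩
  · exact { continuous_mul := continuous_of_discreteTopology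
            continuous_inv := continuous_of_discreteTopology }
  · refine ⟨Finset.univ, ?_⟩
    rw [Finset.coe_univ, Subgroup.closure_univ, Subgroup.coe_top]
    exact dense_univ

end FiniteGroup

/-! ### Kronecker: the elements of `L^×` with vanishing arithmetic divisor form a finite set -/

section Torsion

variable {L : Type*} [Field L] [NumberField L]

/-- An `x ∈ L^×` with `div(x) = 0` is (the image of) a torsion unit of `𝓞 L`: all finite absolute
values of `x`, `x⁻¹` are `1`, so both are algebraic integers, and all archimedean absolute values are
`1` ("`O^×(A) = μ(L)`", Ex. 6.3 p. 113; cf. `principalArithDivisor_eq_zero_iff`).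
[cite: MochizukiFrdI2008, Ex. 6.3 p.113] -/
theorem exists_torsion_map_eq_of_principalArithDivisor_eq_zero {x : Lˣ}
    (h : principalArithDivisor L x = 0) :
    ∃ u : (𝓞 L)ˣ, u ∈ NumberField.Units.torsion L ∧
      Units.map (algebraMap (𝓞 L) L : 𝓞 L →* L) u = x := by
  have hfin := finitePlace_apply_eq_one_of_div_eq_zero h
  have hfin' : ∀ w : FinitePlace L, w ((x⁻¹ : Lˣ) : L) = 1 := fun w => by
    rw [Units.val_inv_eq_inv_val, map_inv₀, hfin w, inv_one]
  obtain ⟨a, ha⟩ := mem_range_algebraMap_of_finitePlace_eq_one hfin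
  obtain ⟨b, hb⟩ := mem_range_algebraMap_of_finitePlace_eq_one hfin'
  have hab : a * b = 1 := by
    apply IsFractionRing.injective (𝓞 L) L
    rw [map_mul, ha, hb, map_one, Units.val_inv_eq_inv_val, mul_inv_cancel₀ x.ne_zero]
  let u : (𝓞 L)ˣ := ⟨a, b, hab, by rw [mul_comm]; exact hab⟩
  have hu : Units.map (algebraMap (𝓞 L) L : 𝓞 L →* L) u = x := Units.ext ha
  refine ⟨u, ?_, hu⟩
  rw [NumberField.Units.mem_torsion]
  intro w
  have := infinitePlace_apply_eq_one_of_div_eq_zero h w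
  rw [← hu] at this
  exact this

/-- **The kernel of `div : L^× → Φ(L)^gp` is finite** ("`= μ(L)`", Ex. 6.3 p. 113): it is contained in
the image of the finite torsion subgroup of `(𝓞 L)^×`. [cite: MochizukiFrdI2008, Ex. 6.3 p.113] -/
theorem setOf_principalArithDivisor_eq_zero_finite :
    Set.Finite {x : Lˣ | principalArithDivisor L x = 0} := by
  refine (Set.finite_range (fun u : NumberField.Units.torsion L =>
    Units.map (algebraMap (𝓞 L) L : 𝓞 L →* L) u.1)).subset ?_
  intro x hx
  obtain ⟨u, hu, hux⟩ := exists_torsion_map_eq_of_principalArithDivisor_eq_zero hx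
  exact ⟨⟨u, hu⟩, hux⟩

end Torsion

/-! ### `O^×(A)` of the model Frobenioid is `ModelFrobenioid.units A` -/

namespace ModelFrobenioid

universe w v u

variable {D : Type u} [Category.{v} D] {Φ B : Dᵒᵖ ⥤ CommMonCat.{w}} {DivB : B ⟶ monoidGp Φ}

/-- For the functor `C → F_Φ` of Thm. 5.2 (i) (`toElem`), found's `O^×(X)` ([FrdI] Def. 1.2 (ii):
base-identity linear automorphisms) IS `ModelFrobenioid.units X` — same carrier, definitionally.
[cite: MochizukiFrdI2008, Thm. 5.2(ii) p.101] -/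
theorem unitsSubgroup_toElem_eq_units (X : ModelFrobenioid Φ B DivB) :
    PreFrobenioid.unitsSubgroup (toElem Φ B DivB) X = units X :=
  SetLike.ext fun _ => Iff.rfl

end ModelFrobenioid

/-! ### `C_{K/F}` is of unit-profinite type -/

section Arith

variable (F : Type) [Field F] [NumberField F] (K : Type) [Field K] [Algebra F K]

/-- In `C_{K/F}`, `Div_B : B(L) = L^× → Φ(L)^gp` kills `u` iff the arithmetic divisor of `u` vanishes
(`Φ(L)^gp = ArithDivisor L`, `EffArithDivisor.gpEquiv`). [cite: MochizukiFrdI2008, Ex. 6.3 p.113] -/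
theorem arith_divB_eq_one_iff (X : FinSubextCat F K) (u : (unitsFunctor F K).obj (op X)) :
    divB (arithDivisorFunctor F K) (unitsFunctor F K) (divNatTrans F K) (op X) u = 1 ↔
      principalArithDivisor X.L u = 0 := by
  change (EffArithDivisor.gpEquiv X.L).symm (principalArithDivisorHom X.L u) = 1 ↔ _
  rw [MulEquiv.map_eq_one_iff]
  exact ⟨fun h => by simpa [principalArithDivisorHom] using congrArg Multiplicative.toAdd h,
    fun h => by simp [principalArithDivisorHom, h]⟩

/-- **`O^×(A)` is finite** for every object `A` of `C_{K/F}` ("`O^×(A) = μ(L)`", Ex. 6.3 p. 113):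
`α ↦ u_α` embeds `O^×(A)` into `Ker(div) ⊆ L^×`, a finite set. [cite: MochizukiFrdI2008, Ex. 6.3 p.113] -/
theorem arith_units_finite (X : arithFrobenioid F K) : Finite (ModelFrobenioid.units X) := by
  have hint : IsIntegral ((arithDivisorFunctor F K).obj (op X.base)) :=
    (EffArithDivisor.isDivisorial X.base.L).isPreDivisorial.isIntegral
  have hsharp : IsSharp ((arithDivisorFunctor F K).obj (op X.base)) :=
    (EffArithDivisor.isDivisorial X.base.L).isSharp
  -- `α ↦ u_α ∈ L^×`, injective, with values in the finite set `{div = 0}`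
  let f : ModelFrobenioid.units X → (X.base.L)ˣ := fun α =>
    ((ModelFrobenioid.unitsToRatFn X α : (unitsFunctor F K).obj (op X.base)) : (X.base.L)ˣ)
  have hf : Function.Injective f := fun α β h =>
    ModelFrobenioid.unitsToRatFn_injective hint (Units.ext h)
  have hmem : ∀ α, f α ∈ {x : (X.base.L)ˣ | principalArithDivisor X.base.L x = 0} := fun α =>
    (arith_divB_eq_one_iff F K X.base _).mp (ModelFrobenioid.divB_unitsToRatFn_eq_one hsharp α)
  haveI : Finite {x : (X.base.L)ˣ | principalArithDivisor X.base.L x = 0} :=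
    (setOf_principalArithDivisor_eq_zero_finite (L := X.base.L)).to_subtype
  exact Finite.of_injective (fun α => (⟨f α, hmem α⟩ : {x : (X.base.L)ˣ | principalArithDivisor X.base.L x = 0}))
    (fun α β h => hf (congrArg Subtype.val h))

/-- **`C_{K/F}` is of unit-profinite type** (Def. 2.8 (i), found's `PreFrobenioid.IsOfUnitProfiniteType`,
for the functor `C_{K/F} → F_Φ` of Thm. 5.2 (i)): every `O^×(A) (= μ(L))` is finite, hence a
topologically finitely generated profinite group for the discrete topology. This is the Def. 2.8 (i)
antecedent of [FrdI] Cor. 5.7 (iii)/(iv) at the arithmetic Frobenioids. [cite: MochizukiFrdI2008, Ex. 6.3 p.113] -/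
theorem isOfUnitProfiniteType_arith :
    PreFrobenioid.IsOfUnitProfiniteType
      (ModelFrobenioid.toElem (arithDivisorFunctor F K) (unitsFunctor F K) (divNatTrans F K)) := by
  intro X
  rw [ModelFrobenioid.unitsSubgroup_toElem_eq_units]
  haveI := arith_units_finite F K X
  exact AdmitsTfgProfiniteTopology.of_finite _

end Arith

end Literature.AlgebraicGeometry.Frobenioids

end
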